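import Summits.ResolutionOfSingularities.ResolutionOfSingularities.Theorems.HilbertSamuelEliminationSigmaMaxModificationsCorridor3MovingCompactnessLeastLabel
import HarnessLib

/-!
# Route `HilbertSamuelElimination`, crux `SigmaMaxModificationsCorridor3` (stmt-ResolutionOfSingularities-19249;
# child of `SigmaMaxModifications` stmt-…-18506), registered skeleton `w_ladder` v5 MOVING (e55bf4f23146f08b),
# stub `stub_movingCompactness` (L∞) — second layer, the CYCLE-END piece of helper 3 of idea-2's line
# `moving-compactness` (`L/res-L1-w42-idea-2/Line-moving-compactness.lean` 89d540dcceefd65f): when the least label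
# present is eventually `j`, the WHOLE label-`j` part is a centre infinitely often

[OURS · L1 W4.2] (cell res-hironaka, LADDER-RESOLUTION rung L, D-0089; volunteer prover seat res-type-005 gen 6; split of
helper 3 offered to its holder res-type-064 2026-08-27T04:4xZ — this file is the piece «every label-`j` cycle END blows up
the whole label-`j` part», the Kőnig threading and the assembly of `stub_movingChain_of_leastLabel_eventuallyConst` are
res-type-064's). NOT statements of H. Hironaka's manuscript [Hironaka2017]; nothing of the manuscript is used or
asserted. AI-written, weaker than expert review.

THE CONTENT (CJS Rem. 6.29 (1), in the tree's rendering `IsCanonicalStep` / `IsReplayStep` / `Pending`). Along a chain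
`c` of canonical near steps:
* every resolution cycle ENDS: from any stage, a later stage is «between cycles» (`P = none`) — the remaining centres
  `Pending.rest` of the replayed lower-dimensional sequence shrink by one at every step inside a cycle, and the step
  replaying an exhausted sequence (`IsReplayStep`, `nil` case) returns the state to `none`
  (`exists_ge_pending_eq_none`);
* a cycle in progress for the label `j` (`Pending.lbl = j`) ends at a step whose centre is `V(𝓘_{Y^{(j)}})`, i.e. whose
  support IS the label-`j` part of the current stratum (`exists_ge_part_subset_support_of_pending`);
* a cycle STARTING at a stage «between cycles» treats the least label present (`IsLeast` ⇒ `sInf` = `leastLabel`);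
* hence, if `leastLabel (c n) = j` for all `n ≥ n₀`: for every `n` there is `m ≥ n` at which the canonical step's centre
  contains the whole label-`j` part `Y_m^{(j)}` (`exists_ge_part_subset_support_of_leastLabel_eventuallyConst`), so
  every marked stage sharing the state of `c m` with its marked point in `Y_m^{(j)}` IS BLOWN UP
  (`isBlownUp_of_mem_part`): the input «the threaded points are blown up infinitely often» of the Kőnig assembly.
Two label-calculus facts for the domination forest of the Kőnig assembly ride along: the least-label part is non-empty,
the least label is `≤ year`, and a label `j ≤ year` upstairs is inherited from a dominated label-`j` component downstairs
(`closure_image_mem_componentsIn_of_next_label_le_year`). No hypothesis on the oracle or on `StateGood` is needed (the chain's own step data are used; uniqueness of the centre is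
not required because `IsBlownUp` is existential in the step data).

## Sources

* V. Cossart, U. Jannsen, S. Saito, *Desingularization: Invariants and Strategy*, LNM 2270 (2020), Rem. 6.29 (1)
  pp. 91–92 («Then we blow up `Y_{m_0}^{(0)}` to get `X_{m_0+1}`»), (6.5)–(6.7). [CossartJannsenSaito2020]
* tree: `Literature.AlgebraicGeometry.Resolution.IsCanonicalStep` / `IsReplayStep` / `Pending` / `CentreSeq.length`
  (CanonicalEliminationSequence, BlowupSequences), `Scheme.IdealSheafData.coe_support_vanishingIdeal` (Mathlib),
  `CampaignW42.MarkedStage` / `CanonicalNearStep` / `MarkedStage.IsBlownUp` (…CampaignW42Tertiary), `leastLabel`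
  (…MovingCompactnessLeastLabel, p496952).
-/

set_option linter.dupNamespace false -- mandated namespace of this single-conjunct summit

noncomputable section

open CategoryTheory AlgebraicGeometry TopologicalSpace Topology
open Summit.ResolutionOfSingularities.ResolutionOfSingularities.Theorems.CampaignW42
open Literature.AlgebraicGeometry.Resolution Literature.RingTheory.HilbertSamuel

namespace Summit.ResolutionOfSingularities.ResolutionOfSingularities.Cruxes.SigmaMaxModifications.MovingCompactnessLine

universe u

variable {R : ∀ S : Scheme.{u}, CentreSeq S → Prop} {N : ℕ} {ν : ℕ → ℕ}

/-! ## One step read off the chain: the next cycle state -/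

/-- The cycle state of the next stage of a chain is the one named by the canonical step taken. [folklore] -/
theorem exists_step_data {c : ℕ → MarkedStage.{u}} (hstep : ∀ n, CanonicalNearStep R N ν (c n) (c (n + 1)))
    (n : ℕ) :
    ∃ (C : (c n).W.IdealSheafData) (P' : Option (Pending (blowup C))),
      IsCanonicalStep R N ν (c n).L (c n).P C P' ∧
        ∃ (h : IsLocallyNoetherian (blowup C)) (x' : ↥(blowup C)),
          c (n + 1) = ⟨blowup C, h, (c n).L.next (Scheme.hsStratum (c n).W N ν) C, P', x'⟩ := by
  obtain ⟨C, P', h, x', hcs, -, -, -, heq⟩ := hstep n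
  exact ⟨C, P', hcs, h, x', heq⟩

/-! ## Every cycle ends: a later stage is between cycles -/

/-- Inside a cycle with `ℓ` replayed centres left, a stage between cycles is reached within `ℓ + 1` steps (the `nil`
replay step returns the state to `none`; a `cons` replay step shortens `rest` by one).
[cite: CossartJannsenSaito2020, Rem. 6.29 (1)] -/
theorem exists_ge_pending_eq_none_of_some {c : ℕ → MarkedStage.{u}}
    (hstep : ∀ n, CanonicalNearStep R N ν (c n) (c (n + 1))) :
    ∀ (ℓ n : ℕ) (Q : Pending (c n).W), (c n).P = some Q → Q.rest.length < ℓ → ∃ m, n ≤ m ∧ (c m).P = none := by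
  intro ℓ
  induction ℓ with
  | zero => intro n Q _ hlt; exact absurd hlt (Nat.not_lt_zero _)
  | succ ℓ ih =>
    intro n Q hP hlt
    obtain ⟨C, P', hcs, h, x', heq⟩ := exists_step_data hstep n
    rw [hP] at hcs
    obtain ⟨-, hrs⟩ := (isCanonicalStep_some_iff R N ν _ Q C P').mp hcs
    obtain ⟨lbl, src, hom, hci, rest⟩ := Q
    cases rest with
    | nil _ =>
      obtain ⟨-, hP'⟩ := (isReplayStep_nil_iff _ _ _ _ _ _).mp hrs
      refine ⟨n + 1, n.le_succ, ?_⟩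
      rw [heq]
      exact hP'
    | cons D t =>
      obtain ⟨-, φ', hφ', -, hP'⟩ := (isReplayStep_cons_iff _ _ _ _ _ _ _ _).mp hrs
      have hP1 : ∃ Q' : Pending (c (n + 1)).W, (c (n + 1)).P = some Q' ∧ Q'.rest.length = t.length := by
        rw [heq]
        exact ⟨⟨lbl, blowup D, φ', hφ', t⟩, hP', rfl⟩
      obtain ⟨Q', hQ', hlen⟩ := hP1
      have hlt' : Q'.rest.length < ℓ := by
        simp only [CentreSeq.length_cons] at hlt
        omega
      obtain ⟨m, hm, hnone⟩ := ih (n + 1) Q' hQ' hlt'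
      exact ⟨m, n.le_succ.trans hm, hnone⟩

/-- **Every resolution cycle ends**: from any stage of the chain, some later stage is between cycles (`P = none`).
[cite: CossartJannsenSaito2020, Rem. 6.29 (1)] -/
theorem exists_ge_pending_eq_none {c : ℕ → MarkedStage.{u}}
    (hstep : ∀ n, CanonicalNearStep R N ν (c n) (c (n + 1))) (n : ℕ) : ∃ m, n ≤ m ∧ (c m).P = none := by
  cases hP : (c n).P with
  | none => exact ⟨n, le_rfl, hP⟩
  | some Q => exact exists_ge_pending_eq_none_of_some hstep (Q.rest.length + 1) n Q hP (Nat.lt_succ_self _)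

/-! ## A cycle for the label `j` ends by blowing up the whole label-`j` part -/

/-- **A cycle in progress for the label `j` ends at a step whose centre contains the whole label-`j` part** of the
current `ν`-stratum (the `nil` replay step: `C = V(𝓘_{Y^{(j)}})`, support `= Y^{(j)}`).
[cite: CossartJannsenSaito2020, Rem. 6.29 (1)] -/
theorem exists_ge_part_subset_support_of_pending {c : ℕ → MarkedStage.{u}}
    (hstep : ∀ n, CanonicalNearStep R N ν (c n) (c (n + 1))) {j : ℕ} :
    ∀ (ℓ n : ℕ) (Q : Pending (c n).W), (c n).P = some Q → Q.rest.length < ℓ → Q.lbl = j →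
      ∃ m, n ≤ m ∧ ∃ (C : (c m).W.IdealSheafData) (P' : Option (Pending (blowup C))),
        IsCanonicalStep R N ν (c m).L (c m).P C P' ∧
          (c m).L.part (Scheme.hsStratum (c m).W N ν) j ⊆ (C.support : Set (c m).W) := by
  intro ℓ
  induction ℓ with
  | zero => intro n Q _ hlt; exact fun _ => absurd hlt (Nat.not_lt_zero _)
  | succ ℓ ih =>
    intro n Q hP hlt hlbl
    obtain ⟨C, P', hcs, h, x', heq⟩ := exists_step_data hstep n
    have hcs₀ := hcs
    rw [hP] at hcs
    obtain ⟨-, hrs⟩ := (isCanonicalStep_some_iff R N ν _ Q C P').mp hcs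
    obtain ⟨lbl, src, hom, hci, rest⟩ := Q
    subst hlbl
    cases rest with
    | nil _ =>
      obtain ⟨⟨h', hC⟩, -⟩ := (isReplayStep_nil_iff _ _ _ _ _ _).mp hrs
      refine ⟨n, le_rfl, C, P', hcs₀, ?_⟩
      rw [hC, Scheme.IdealSheafData.coe_support_vanishingIdeal]
      exact subset_rfl
    | cons D t =>
      obtain ⟨-, φ', hφ', -, hP'⟩ := (isReplayStep_cons_iff _ _ _ _ _ _ _ _).mp hrs
      have hP1 : ∃ Q' : Pending (c (n + 1)).W,
          (c (n + 1)).P = some Q' ∧ Q'.rest.length = t.length ∧ Q'.lbl = lbl := by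
        rw [heq]
        exact ⟨⟨lbl, blowup D, φ', hφ', t⟩, hP', rfl, rfl⟩
      obtain ⟨Q', hQ', hlen, hlbl'⟩ := hP1
      have hlt' : Q'.rest.length < ℓ := by
        simp only [CentreSeq.length_cons] at hlt
        omega
      obtain ⟨m, hm, hrest⟩ := ih (n + 1) Q' hQ' hlt' hlbl'
      exact ⟨m, n.le_succ.trans hm, hrest⟩

/-- **A cycle STARTING at a stage between cycles treats the least label present**: if `(c n).P = none` and
`leastLabel (c n) = j`, a later step has the whole label-`j` part in its centre (at once if the oracle's sequence for
`Y^{(j)}` is empty, else at the end of the cycle just begun). [cite: CossartJannsenSaito2020, Rem. 6.29 (1)] -/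
theorem exists_ge_part_subset_support_of_none {c : ℕ → MarkedStage.{u}}
    (hstep : ∀ n, CanonicalNearStep R N ν (c n) (c (n + 1))) {j n : ℕ} (hP : (c n).P = none)
    (hj : leastLabel N ν (c n) = j) :
    ∃ m, n ≤ m ∧ ∃ (C : (c m).W.IdealSheafData) (P' : Option (Pending (blowup C))),
      IsCanonicalStep R N ν (c m).L (c m).P C P' ∧
        (c m).L.part (Scheme.hsStratum (c m).W N ν) j ⊆ (C.support : Set (c m).W) := by
  obtain ⟨C, P', hcs, h, x', heq⟩ := exists_step_data hstep n
  have hcs₀ := hcs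
  rw [hP] at hcs
  obtain ⟨j', hj', h', t, -, hrs⟩ := (isCanonicalStep_none_iff R N ν _ C P').mp hcs
  have hjj : j' = j := by
    rw [← hj, leastLabel, hj'.csInf_eq]
  subst hjj
  cases t with
  | nil _ =>
    obtain ⟨⟨h'', hC⟩, -⟩ := (isReplayStep_nil_iff _ _ _ _ _ _).mp hrs
    refine ⟨n, le_rfl, C, P', hcs₀, ?_⟩
    rw [hC, Scheme.IdealSheafData.coe_support_vanishingIdeal]
    exact subset_rfl
  | cons D t' =>
    obtain ⟨-, φ', hφ', -, hP'⟩ := (isReplayStep_cons_iff _ _ _ _ _ _ _ _).mp hrs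
    have hP1 : ∃ Q' : Pending (c (n + 1)).W,
        (c (n + 1)).P = some Q' ∧ Q'.rest.length = t'.length ∧ Q'.lbl = j' := by
      rw [heq]
      exact ⟨⟨j', blowup D, φ', hφ', t'⟩, hP', rfl, rfl⟩
    obtain ⟨Q', hQ', hlen, hlbl'⟩ := hP1
    obtain ⟨m, hm, hrest⟩ :=
      exists_ge_part_subset_support_of_pending hstep (Q'.rest.length + 1) (n + 1) Q' hQ' (Nat.lt_succ_self _) hlbl'
    exact ⟨m, n.le_succ.trans hm, hrest⟩

/-! ## The cycle-end piece of helper 3 -/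

/-- **If the least label present is `j` from stage `n₀` on, the WHOLE label-`j` part is a centre infinitely often**: for
every `n` there is `m ≥ n` at which the canonical step's centre contains `Y_m^{(j)}`.
[cite: CossartJannsenSaito2020, Rem. 6.29 (1), p. 92] -/
theorem exists_ge_part_subset_support_of_leastLabel_eventuallyConst {c : ℕ → MarkedStage.{u}}
    (hstep : ∀ n, CanonicalNearStep R N ν (c n) (c (n + 1))) {j n₀ : ℕ}
    (hconst : ∀ n, n₀ ≤ n → leastLabel N ν (c n) = j) (n : ℕ) :
    ∃ m, n ≤ m ∧ ∃ (C : (c m).W.IdealSheafData) (P' : Option (Pending (blowup C))),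
      IsCanonicalStep R N ν (c m).L (c m).P C P' ∧
        (c m).L.part (Scheme.hsStratum (c m).W N ν) j ⊆ (C.support : Set (c m).W) := by
  obtain ⟨m₁, hm₁, hnone⟩ := exists_ge_pending_eq_none hstep (max n n₀)
  obtain ⟨m, hm, hrest⟩ := exists_ge_part_subset_support_of_none hstep hnone
    (hconst m₁ ((le_max_right n n₀).trans hm₁))
  exact ⟨m, ((le_max_left n n₀).trans hm₁).trans hm, hrest⟩


/-- **Alias in the name announced by the helper-3 holder** (res-type-064 2026-08-27T04:50:25Z): same statement as
`exists_ge_part_subset_support_of_leastLabel_eventuallyConst` (only the chain and the eventual constancy are needed).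
[cite: CossartJannsenSaito2020, Rem. 6.29 (1), p. 92] -/
theorem exists_cycleEnd_of_leastLabel_eventuallyConst {c : ℕ → MarkedStage.{u}}
    (hstep : ∀ n, CanonicalNearStep R N ν (c n) (c (n + 1))) {j n₀ : ℕ}
    (hj : ∀ n, n₀ ≤ n → leastLabel N ν (c n) = j) (n : ℕ) :
    ∃ m, n ≤ m ∧ ∃ (C : (c m).W.IdealSheafData) (P' : Option (Pending (blowup C))),
      IsCanonicalStep R N ν (c m).L (c m).P C P' ∧
        (c m).L.part (Scheme.hsStratum (c m).W N ν) j ⊆ (C.support : Set (c m).W) :=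
  exists_ge_part_subset_support_of_leastLabel_eventuallyConst hstep hj n

/-- A marked stage whose marked point lies in a part contained in the centre of a canonical step from its state IS
BLOWN UP. [folklore] -/
theorem isBlownUp_of_mem_part {s : MarkedStage.{u}} {j : ℕ} {C : s.W.IdealSheafData}
    {P' : Option (Pending (blowup C))} (hcs : IsCanonicalStep R N ν s.L s.P C P')
    (hsub : s.L.part (Scheme.hsStratum s.W N ν) j ⊆ (C.support : Set s.W))
    (hpt : s.pt ∈ s.L.part (Scheme.hsStratum s.W N ν) j) : s.IsBlownUp R N ν :=
  ⟨C, P', hcs, hsub hpt⟩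

/-- **Re-marked stages in the label-`j` part are blown up infinitely often** (the form consumed by the Kőnig assembly):
if the least label present is `j` from `n₀` on, then for every `n` there is `m ≥ n` such that EVERY marked stage with
the state of `c m` and marked point in `Y_m^{(j)}` is blown up. [cite: CossartJannsenSaito2020, Rem. 6.29 (1), p. 92] -/
theorem exists_ge_forall_isBlownUp_of_leastLabel_eventuallyConst {c : ℕ → MarkedStage.{u}}
    (hstep : ∀ n, CanonicalNearStep R N ν (c n) (c (n + 1))) {j n₀ : ℕ}
    (hconst : ∀ n, n₀ ≤ n → leastLabel N ν (c n) = j) (n : ℕ) :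
    ∃ m, n ≤ m ∧ ∀ y ∈ (c m).L.part (Scheme.hsStratum (c m).W N ν) j,
      MarkedStage.IsBlownUp R N ν ⟨(c m).W, (c m).ln, (c m).L, (c m).P, y⟩ := by
  obtain ⟨m, hm, C, P', hcs, hsub⟩ := exists_ge_part_subset_support_of_leastLabel_eventuallyConst hstep hconst n
  exact ⟨m, hm, fun y hy => ⟨C, P', hcs, hsub hy⟩⟩

/-- In particular the chain's own marked point is blown up at such a stage whenever it lies in the label-`j` part.
[cite: CossartJannsenSaito2020, Rem. 6.29 (1)] -/
theorem exists_ge_isBlownUp_of_mem_part_of_leastLabel_eventuallyConst {c : ℕ → MarkedStage.{u}}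
    (hstep : ∀ n, CanonicalNearStep R N ν (c n) (c (n + 1))) {j n₀ : ℕ}
    (hconst : ∀ n, n₀ ≤ n → leastLabel N ν (c n) = j) (n : ℕ) :
    ∃ m, n ≤ m ∧ ((c m).pt ∈ (c m).L.part (Scheme.hsStratum (c m).W N ν) j → (c m).IsBlownUp R N ν) := by
  obtain ⟨m, hm, C, P', hcs, hsub⟩ := exists_ge_part_subset_support_of_leastLabel_eventuallyConst hstep hconst n
  exact ⟨m, hm, fun hpt => isBlownUp_of_mem_part hcs hsub hpt⟩


/-! ## Two label-calculus facts for the domination forest (consumed by the Kőnig assembly) -/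

/-- The part of the least label present is non-empty as soon as the stratum is. [folklore] -/
theorem part_leastLabel_nonempty (N : ℕ) (ν : ℕ → ℕ) (s : MarkedStage.{u})
    (hne : (Scheme.hsStratum s.W N ν).Nonempty) :
    (s.L.part (Scheme.hsStratum s.W N ν) (leastLabel N ν s)).Nonempty :=
  Nat.sInf_mem ((s.L.exists_part_nonempty_iff _).mpr hne)

/-- **A label `j ≤ year` upstairs is INHERITED**: if all labels downstairs are `≤ year` and a subset `Z'` of the blow-up
carries the label `j ≤ year` under `Labelling.next`, then `Z'` dominates a component of `Y` with label `j` (the other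
branch of `Labelling.next` gives the label `year + 1 > j`). This is what makes the label-`j` components of successive
strata a finitely-branching inverse system. [cite: CossartJannsenSaito2020, Rem. 6.29 (1)] -/
theorem closure_image_mem_componentsIn_of_next_label_le_year {W : Scheme.{u}} (L : Labelling W) (Y : Set W)
    (C : W.IdealSheafData) (hlab : ∀ Z : Set W, L.label Z ≤ L.year) {Z' : Set ↥(blowup C)} {j : ℕ}
    (hj : (L.next Y C).label Z' = j) (hjy : j ≤ L.year) :
    closure (blowup.π C '' Z') ∈ componentsIn Y ∧ L.label (closure (blowup.π C '' Z')) = j := by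
  by_cases h : closure (blowup.π C '' Z') ∈ componentsIn Y
  · refine ⟨h, ?_⟩
    rwa [L.next_label_of_mem C h] at hj
  · exfalso
    rw [L.next_label_of_not_mem C h] at hj
    have := hlab (closure (blowup.π C '' Z'))
    omega

/-- Along a chain from `MarkedStage.init X x`, `x ∈ X(ν)`: the least label present never exceeds the year (it is `≤` the
label of the component through the marked point). [folklore] -/
theorem leastLabel_le_year_of_chain {X : Scheme.{u}} [IsLocallyNoetherian X] {x : X}
    (hx : x ∈ Scheme.hsStratum X N ν) {c : ℕ → MarkedStage.{u}} (h0 : c 0 = MarkedStage.init X x)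
    (hstep : ∀ n, CanonicalNearStep R N ν (c n) (c (n + 1))) (n : ℕ) :
    leastLabel N ν (c n) ≤ (c n).L.year := by
  obtain ⟨hlab, hpt⟩ := invariants_of_chain hx h0 hstep n
  obtain ⟨Z₀, hZ₀, -⟩ := componentsIn.exists_mem hpt
  exact (leastLabel_le_label N ν (c n) hZ₀).trans (hlab Z₀)

end Summit.ResolutionOfSingularities.ResolutionOfSingularities.Cruxes.SigmaMaxModifications.MovingCompactnessLine

end
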